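import Summits.ABC.IUTFork.Repair.CandMochizuki32
import Summits.ABC.IUTFork.Cor312PilotKummerNaturalWitness
import Summits.ABC.IUTFork.Cor312UnitCountermodel
import Summits.ABC.IUTFork.Cor312PilotKummerCompatProtocolSatPlus
import HarnessLib

/-!
# REPAIR branch B1 / CandMochizuki32Profile — PROFILE v0.4 points P♮ (v2: U; v3: FLIP, the honest SAT+ witness for M32c) for rows RP-M32a/b/c (and the AO4-shape of RP-X07c)

PROOF-ONLY file (no definition, no `Prop` fact; class `Mochizuki`, sub-cell B1, seat abc-iut-rp-m3; abc-iut-rp-plan RULINGS #11 (2) «PROFILE v0.4: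
level-H/S rows get P♮ (does H hold where S holds non-identified? — a candidate FALSE at P♮ is STRONGER than S there) … authors: one
example/theorem per point, by name»). TAKES NO SIDE; nothing asserted about [IUTchIII] Cor. 3.12; typed ≠ proved; instantiated ≠ endorsed.

P♮ = abc-iut-w5-d230's NON-IDENTIFIED natural model `NaturalWitness.natSetting` over `natFull` with the one operator `segRegion` and q-datum
`qDatumNat` (`Cor312PilotKummerNaturalWitness`, p429252): the three pins hold, the typed Thm 3.11 holds, the (Ind2)-move `flipFamily` carries
the Θ-region `halfPos` onto the q-region `halfNeg` — so S (`PilotKummerIndRelated`) HOLDS through a GENUINE indeterminacy while the two regions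
are DISTINCT (`natSetting_regions_ne`), and the typed Corollary holds strictly.

RESULTS: `H_nat`, `H'_nat`, `H''_nat` — the three readings of Rmk 3.12.2 (ii) (f^itw)/(f^toy) of `Repair.CandMochizuki32` (p427902) HOLD at P♮
(region: via `natSetting_reading3`; volume and hull: from the region reading); `not_identification_nat` — the NO-indeterminacy identification
«∃ m, qRegion = thetaRegion m» (the ∧ of [EssLgc] (AOΘ4), `Repair.CandMochizuki33.AO4` unfolded, p430360) FAILS at P♮ although S holds there:
that reading is STRICTLY STRONGER than S (separating model = P♮); packaged `profile_nat`. Cells: RP-M32a/b/c P♮ = HOLDS (consistent with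
`H ⟺ S` under the pins, `H'`/`H''` weaker); RP-X07c P♮ = FAILS (stronger than S). [claim: Mochizuki2012, status: disputed]
-/

noncomputable section

open Set

namespace Summit.ABC.IUTFork.Repair.CandMochizuki32Profile

open Thm311 Cor312 Cor312.Checks Cor312.IdentifiedNonVacuity Cor312Vol Cor312Vol.NaturalWitness Repair.CandMochizuki32
  Literature.IUT.LogThetaLattice

/-- **RP-M32a at P♮: `H` HOLDS** (Reading R3 holds at the natural model, through the flip indeterminacy: `natSetting_reading3`). [folklore] -/
theorem H_nat : H natFull.toLatticeSituation natSetting segRegion qDatumNat :=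
  (H_iff_reading3 _ _ _ _).2 natSetting_reading3

/-- **RP-M32b at P♮: `H'` HOLDS** (the q-region is itself a possible image). [folklore] -/
theorem H'_nat : H' natFull.toLatticeSituation natSetting segRegion qDatumNat := H'_of_H _ _ _ _ H_nat

/-- **RP-M32c at P♮: `H''` HOLDS** (region ⟹ hull). [folklore] -/
theorem H''_nat : H'' natFull.toLatticeSituation natSetting segRegion qDatumNat := H''_of_H _ _ _ _ H_nat

/-- **RP-X07c's AO4-shape at P♮ FAILS**: at the label `j = 1` the q-pilot region `halfNeg` is NO Kummer image `thetaRegion m = halfPos` of the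
Θ-pilot — identification WITHOUT indeterminacy fails where S holds through a genuine one. [folklore] -/
theorem not_identification_nat : ¬ ∀ (j : toyIndex.Label) (vQ : toyIndex.VQ), ∃ m : ℤ, natSetting.qRegion j vQ = natSetting.thetaRegion m j vQ := by
  intro h
  obtain ⟨m, hm⟩ := h 1 ()
  have h1 : (1 : toyIndex.Label) ≠ 0 := by decide
  rw [(natSetting_regions_of_ne_zero h1 ()).2, natSetting_thetaRegion, thetaRegionNat_one_of_ne_zero h1] at hm
  exact (natHul_not_subset 1 ()).2.2.2.1 hm.le

/-- **PROFILE POINT P♮, packaged**: typed Thm 3.11 ∧ BridgeHyps ∧ AbsLogQPos ∧ PinnedRegions3 ∧ S ∧ ¬IdentifiedReading ∧ `H` ∧ `H'` ∧ `H''` ∧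
¬(identification without indeterminacy) ∧ Statement — the three Rmk 3.12.2 readings hold wherever S holds non-identified; the label-deleted ∧ of
[EssLgc] (AOΘ4) does not. [folklore] -/
theorem profile_nat :
    natFull.Statement ∧ BridgeHyps natSetting ∧ natSetting.AbsLogQPos ∧
      PinnedRegions3 natFull.toLatticeSituation natSetting segRegion qDatumNat ∧
      PilotKummerIndRelated natFull.toLatticeSituation natSetting segRegion qDatumNat ∧ ¬ natSetting.IdentifiedReading ∧
      H natFull.toLatticeSituation natSetting segRegion qDatumNat ∧ H' natFull.toLatticeSituation natSetting segRegion qDatumNat ∧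
      H'' natFull.toLatticeSituation natSetting segRegion qDatumNat ∧
      (¬ ∀ (j : toyIndex.Label) (vQ : toyIndex.VQ), ∃ m : ℤ, natSetting.qRegion j vQ = natSetting.thetaRegion m j vQ) ∧
      natSetting.Statement :=
  ⟨natFull_statement, natSetting_bridgeHyps, natSetting_absLogQPos, natSetting_pinnedRegions3, natSetting_pilotKummerIndRelated,
    natSetting_not_identifiedReading, H_nat, H'_nat, H''_nat, not_identification_nat, natSetting_statement_strict.1⟩

/-! ## 2. PROFILE point U (appended v2): abc-iut-w4-d101's unit countermodel `UnitWitness.uSetting` over `uFull` (p-adic UNITS as (Ind2)) -/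

section Units

open Cor312Vol.UnitWitness Cor312Vol.PinnedWitness

variable (p : ℕ) [hp : Fact p.Prime]

/-- **RP-M32a at U: `H` FAILS** (the typed Corollary fails at `uSetting` while `H` would give it from the bridge hypotheses: contrapose
`statement_of_H`; equivalently R3 fails there, `uSetting_not_reading3`). [folklore] -/
theorem not_H_unit : ¬ H (uFull p).toLatticeSituation (uSetting p) (orbitRegion p) (qDatum p) := fun h =>
  uSetting_not_statement p (statement_of_H _ _ _ _ (uSetting_bridgeHyps p) h)

/-- **RP-M32b at U: `H'` FAILS** (contrapose `statement_of_H'`). [folklore] -/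
theorem not_H'_unit : ¬ H' (uFull p).toLatticeSituation (uSetting p) (orbitRegion p) (qDatum p) := fun h =>
  uSetting_not_statement p (statement_of_H' _ _ _ _ (uSetting_bridgeHyps p) h)

/-- **RP-M32c at U: `H''` FAILS** (contrapose `statement_of_H''`; = `uSetting_not_licence`). [folklore] -/
theorem not_H''_unit : ¬ H'' (uFull p).toLatticeSituation (uSetting p) (orbitRegion p) (qDatum p) := fun h =>
  uSetting_not_statement p (statement_of_H'' _ _ _ _ (uSetting_bridgeHyps p) h)

/-- **RP-X07c's AO4-shape at U FAILS** (an identification `qRegion = thetaRegion m = B_{j²} = thetaRegion3` would make the q-region a possible image,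
contradicting `uSetting_not_reading3`). [folklore] -/
theorem not_identification_unit :
    ¬ ∀ (j : toyIndex.Label) (vQ : toyIndex.VQ), ∃ m : ℤ, (uSetting p).qRegion j vQ = (uSetting p).thetaRegion m j vQ := by
  intro h
  refine uSetting_not_reading3 p fun i vQ => ?_
  obtain ⟨m, hm⟩ := h (Setting.labelSucc i) vQ
  rw [hm, uSetting_thetaRegion, ← uSetting_thetaRegion3]
  exact (uSetting p).thetaRegion3_mem_possibleImages _ vQ

/-- **PROFILE POINT U, packaged**: typed Thm 3.11 (genuine unit (Ind2), lines pairwise distinct) ∧ BridgeHyps ∧ AbsLogQPos ∧ PinnedRegions3 hold at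
`uSetting`, and `H`, `H'`, `H''`, the AO4-shape, S and the Statement all FAIL there — the three Rmk 3.12.2 readings behave at U exactly as at the
sign countermodel CM (they FAIL where S fails): no (Ind)-sensitivity is hidden in them. [folklore] -/
theorem profile_unit :
    (uFull p).Statement ∧ BridgeHyps (uSetting p) ∧ (uSetting p).AbsLogQPos ∧
      PinnedRegions3 (uFull p).toLatticeSituation (uSetting p) (orbitRegion p) (qDatum p) ∧
      ¬ H (uFull p).toLatticeSituation (uSetting p) (orbitRegion p) (qDatum p) ∧
      ¬ H' (uFull p).toLatticeSituation (uSetting p) (orbitRegion p) (qDatum p) ∧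
      ¬ H'' (uFull p).toLatticeSituation (uSetting p) (orbitRegion p) (qDatum p) ∧
      (¬ ∀ (j : toyIndex.Label) (vQ : toyIndex.VQ), ∃ m : ℤ, (uSetting p).qRegion j vQ = (uSetting p).thetaRegion m j vQ) ∧
      ¬ PilotKummerIndRelated (uFull p).toLatticeSituation (uSetting p) (orbitRegion p) (qDatum p) ∧ ¬ (uSetting p).Statement :=
  ⟨uFull_statement p, uSetting_bridgeHyps p, uSetting_absLogQPos p, uSetting_pinnedRegions3 p, not_H_unit p, not_H'_unit p, not_H''_unit p,
    not_identification_unit p, uSetting_not_pilotKummerIndRelated p, uSetting_not_statement p⟩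

end Units

/-! ## 3. PROFILE point FLIP (appended v3): abc-iut-w4-d103's frame-flip model `flipSetting` — the HONEST SAT+ witness for RP-M32c
(answering rp-ref-3's grade note 07:05:00Z: the LS witness `shellSetting 2 3` dilates the Θ-glue, hence is SAT⊖ under v0.3; at `flipSetting` the
Θ-image is the honest `B_{j²}`, the q-image `B_1`, and the hull inflation `(j² − 1)·log p` comes from the coarse FRAME) -/

section Flip

open Cor312Vol.PinnedWitness Cor312Vol.PinnedHonest Cor312Vol.NaiveWitness Cor312Vol.RepairProtocol

variable (p : ℕ) [hp : Fact p.Prime]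

omit hp in
/-- **RP-M32c at FLIP: `H''` HOLDS** — at every label of `𝔽_l^⋇` the q-image `B_1` IS the packet hull (`flip_thetaHull`); at the zero label the
q-image `B_0` is the Θ-region itself, hence inside the hull of the union of the possible images. [folklore] -/
theorem H''_flip : H'' (naiveFull p).toLatticeSituation (flipSetting p) (orbitRegion p) (qDatum p) := by
  refine (H''_iff_subset_hull _ _ _ _).2 fun j vQ => ?_
  rcases Fin.eq_zero_or_eq_succ j with rfl | ⟨i, rfl⟩
  · have h0 : (flipSetting p).qRegion 0 vQ = (flipSetting p).thetaRegion3 0 vQ := by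
      rw [flip_thetaRegion3, show jsq (0 : toyIndex.Label) = 0 from by decide]
      exact pinnedSetting_qRegion_zero p vQ
    rw [h0]
    exact (Set.subset_sUnion_of_mem ((flipSetting p).thetaRegion3_mem_possibleImages 0 vQ)).trans
      (((flipSetting p).frame 0 vQ).subset_hull _)
  · show (pinnedSetting p).qRegion (Setting.labelSucc i) vQ ⊆ (flipSetting p).thetaHull (Setting.labelSucc i) vQ
    rw [flip_thetaHull, pinnedSetting_qRegion_of_ne_zero p (Setting.labelSucc_ne_zero i)]

include p in
/-- **RP-M32c T-c = SAT+ at the HONEST frame-flip model** (P6 `RepairProtocol.satPlus_of_holds_at_flipSetting` BY NAME): typed Thm 3.11 ∧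
MultiradialCompat ∧ KummerB ∧ BridgeHyps ∧ AbsLogQPos ∧ PinnedRegions3 ∧ Step (x) invariance ∧ admissible (Ind3)-regions ∧ HONEST `j²`-scaling ∧
label-independent NEGATIVE q-volume ∧ `H''` ∧ PilotKummerCompatHull ∧ Licence ∧ Statement ∧ ¬S — the whole honesty checklist, with the hull
inflation produced by the frame, not by a dilated glue. [folklore] -/
theorem H''_satPlus_flip :
    ∃ (T : ThetaIndex) (F : FullSituation T) (P : Cor312.Setting F.toLatticeSituation.toSituation)
      (ρ : (∀ v : T.V, v ∈ T.Vbad → Set (F.L.StarPacket v)) → ∀ (j : T.Label) (vQ : T.VQ), Set (F.L.Packet j vQ))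
      (qK : ∀ v : T.V, v ∈ T.Vbad → Set (F.L.StarPacket v)),
      F.Statement ∧ F.MultiradialCompat ∧ (F.col P.n).KummerB (F.D P.n) ∧ BridgeHyps P ∧ P.AbsLogQPos ∧
        PinnedRegions3 F.toLatticeSituation P ρ qK ∧
        (∀ Φ ∈ F.L.Ind1Family ∪ F.L.Ind2Family, ∀ j vQ (B : Set (F.L.Packet j vQ)),
          (F.D P.n).Adm j vQ B ↔ (F.D P.n).Adm j vQ (Φ j vQ '' B)) ∧
        (F.D P.n).LogvolInvariant ∧
        (∀ (j : T.Label) (vQ : T.VQ), (F.D P.n).Adm j vQ (P.thetaRegion3 j vQ)) ∧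
        (∀ (i : Fin T.lstar) (vQ : T.VQ),
          (F.D P.n).logvol _ vQ (P.thetaRegion3 (Setting.labelSucc i) vQ) =
            (((i : ℕ) + 1 : ℕ) : ℝ) ^ 2 * P.qLocal (Setting.labelSucc i) vQ) ∧
        (∀ (i i' : Fin T.lstar) (vQ : T.VQ), P.qLocal (Setting.labelSucc i) vQ = P.qLocal (Setting.labelSucc i') vQ) ∧
        (∀ (i : Fin T.lstar) (vQ : T.VQ), P.qLocal (Setting.labelSucc i) vQ < 0) ∧
        H'' F.toLatticeSituation P ρ qK ∧
        PilotKummerCompatHull F.toLatticeSituation P ρ qK ∧ Thm311ToCor312.Licence P ∧ P.Statement ∧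
        ¬ PilotKummerIndRelated F.toLatticeSituation P ρ qK :=
  satPlus_of_holds_at_flipSetting (fun S P ρ qK => H'' S P ρ qK) p (H''_flip p)

/-- `H` (region reading) FAILS at flip (honest model, S false there: contrapose `S_of_H` against the package's last conjunct is immediate; here
directly from ¬R3, `flip_not_gapA3`). [folklore] -/
theorem not_H_flip : ¬ H (naiveFull p).toLatticeSituation (flipSetting p) (orbitRegion p) (qDatum p) := fun h =>
  flip_not_gapA3 p (gapA3_of_reading3 _ _ _ _ ((H_iff_reading3 _ _ _ _).1 h))

end Flip

/-! ## 4. PROFILE point FLIP completed (appended v4, gen 2): `H'` at the frame-flip model -/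

section FlipVolume

open Cor312Vol.PinnedWitness Cor312Vol.PinnedHonest Cor312Vol.NaiveWitness

variable (p : ℕ) [hp : Fact p.Prime]

/-- **RP-M32b at FLIP: `H'` FAILS** — `flipSetting` has the glue, pilots, column and possible images of `pinnedSetting` (only the hull frame
differs, `flip_fields_eq` / `flip_possibleImages`), and the volume reading `H'` reads only those: at `j = 2` the unique possible image is the
honest `B_4` of log-volume `−4·log p` while the q-pilot's local log-volume is `μ(B_1) = −log p` (`not_H'_pinned`, by definitional transport).
So at the honest frame-flip bed the HULL reading `H''` holds (`H''_flip`) while BOTH stronger readings `H`, `H'` fail. [folklore] -/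
theorem not_H'_flip : ¬ H' (naiveFull p).toLatticeSituation (flipSetting p) (orbitRegion p) (qDatum p) := fun h =>
  not_H'_pinned p fun i vQ => h i vQ

/-- **FLIP column for RP-M32a/b/c, packaged**: at `flipSetting p` — `H''` ✓, `H` ✗, `H'` ✗. [folklore] -/
theorem profile_flip :
    H'' (naiveFull p).toLatticeSituation (flipSetting p) (orbitRegion p) (qDatum p) ∧
      ¬ H (naiveFull p).toLatticeSituation (flipSetting p) (orbitRegion p) (qDatum p) ∧
      ¬ H' (naiveFull p).toLatticeSituation (flipSetting p) (orbitRegion p) (qDatum p) :=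
  ⟨H''_flip p, not_H_flip p, not_H'_flip p⟩

end FlipVolume

end Summit.ABC.IUTFork.Repair.CandMochizuki32Profile

end
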